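import Literature.AlgebraicGeometry.Morphisms.ProjectiveOfFibreEmbedding
import HarnessLib

/-!
# Global sections generate a line bundle along a fibre on which its restriction is generated and `H¹` vanishes

Topic `AlgebraicGeometry/Morphisms`; namespace `Literature.AlgebraicGeometry.Morphisms`. THEOREMS ONLY (no definition, no
named fact, no instance, no `sorry`).

`f : X → Spec A` proper and flat, `A` noetherian, `E` an `𝒪_X`-module with a rank-one frame system `F`, `𝔭 ∈ Spec A`,
`X₀ = X ×_A κ(𝔭)` ANY cartesian square `HX`. If `Ext¹_{𝒪_{X₀}}(𝒪_{X₀}, E|_{X₀}) = 0` and `E|_{X₀}` is generated by ITS OWN global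
sections (at every point of `X₀` some section of `E|_{X₀} = iX^*E` has a unit coefficient), then the GLOBAL sections `Γ(X, E)`
generate `E` along the fibre `f⁻¹(𝔭)` (`exists_mem_basicOpen_coeffAt_of_fibre`): the relative-generation half («`π^*π_*E → E` is
onto near the fibre») of EGA III 4.7.1 / Mumford §5 Cor. 3, in the ★ `coeffAt` currency and indexed by the family `id` of ALL
global sections. Over all primes (`forall_exists_mem_basicOpen_coeffAt_of_fibres`, canonical fibres `X ×_A κ(𝔭)` = Mathlib
`pullback`) the conclusion is the cover hypothesis `⨆_{t, x} X_{coeffAt id t x} = ⊤` of ★ `GeneratingSections.ofCocycleSections`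
(`iSup_basicOpen_coeffAt_id_eq_top_of_fibres`), i.e. `E` is generated by global sections and defines `X → ℙ(Γ(X, E))`.

Road: ★ G5 `span_unitSectionLE_top_eq_top_at_prime` (a generating fibre section is a `κ(𝔭)`-combination of restricted global
sections, so one of them has a unit coefficient at the point: ★ `coeffAt_sum_smul` + Mathlib `Scheme.basicOpen_add_le`) and ★
`mem_basicOpen_coeffAt_of_pullback` (the coefficient of `η(t)` in the pulled-back frame is the pulled-back coefficient).

Cell `hodgecm-mathlib`, F-DAG (h2) F-2a capital (B-p20 (g11)); consumer: the F-6 functor side (`T`-point `(A, λ, level, frame)`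
↦ `A_T → ℙ^m_T`). Count-neutral (HC_CM is proved only modulo the 7 printed citations until rung 0 closes).

## References
* A. Grothendieck, J. Dieudonné, *EGA III₁* (Publ. Math. IHÉS 11, 1961), Thm. 4.7.1. [EGAIII1]
* D. Mumford, *Abelian Varieties* (1970), §5 Cor. 3 (p. 53). [MumfordAV1970]
* R. Hartshorne, *Algebraic Geometry* (1977), II Thm. 7.1 (proof), III Thm. 12.11. [Hartshorne1977]
-/

universe u

open CategoryTheory CategoryTheory.Limits CategoryTheory.Abelian AlgebraicGeometry TopologicalSpace Opposite
open Literature.AlgebraicGeometry.Modules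
open Literature.AlgebraicGeometry.Motives Literature.AlgebraicGeometry.Motives.GeneratingSections

-- `TopCat.Presheaf`/`Scheme.Modules` bookkeeping (as in ★ `Motives/GeneratingSectionsOfLineBundle`).
set_option backward.isDefEq.respectTransparency false

noncomputable section

namespace Literature.AlgebraicGeometry.Morphisms

/-- In a cartesian square `fst ≫ f = snd ≫ g`, a point `x` with `f x = g y` lies in the range of `fst`. [folklore] -/
private theorem mem_range_fst_of_isPullback {P X' Y Z : Scheme.{u}} {fst : P ⟶ X'} {snd : P ⟶ Y} {f : X' ⟶ Z}
    {g : Y ⟶ Z} (h : IsPullback fst snd f g) (x : X') (y : Y) (hxy : f x = g y) : x ∈ Set.range fst := by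
  haveI : HasPullback f g := h.hasPullback
  obtain ⟨z, hz, -⟩ := Scheme.Pullback.exists_preimage_pullback x y hxy
  refine ⟨h.isoPullback.inv z, ?_⟩
  rw [← Scheme.Hom.comp_apply, IsPullback.isoPullback_inv_fst, hz]

/-- `X_{∑_j r_j · u_j} ⊆ ⋃_j X_{u_j}`: where a finite combination does not vanish, some term does not vanish. [folklore] -/
private theorem basicOpen_sum_mul_le {Y : Scheme.{u}} {U : Y.Opens} {κ : Type*} (T : Finset κ) (r u : κ → Γ(Y, U)) :
    Y.basicOpen (∑ j ∈ T, r j * u j) ≤ ⨆ j, Y.basicOpen (u j) := by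
  classical
  refine Finset.sum_induction _ (fun s ↦ Y.basicOpen s ≤ ⨆ j, Y.basicOpen (u j))
    (fun x y hx hy ↦ (Y.basicOpen_add_le x y).trans (sup_le hx hy)) ?_ fun j _ ↦ ?_
  · rw [Scheme.basicOpen_zero]
    exact bot_le
  · rw [Scheme.basicOpen_mul]
    exact inf_le_right.trans (le_iSup (fun j ↦ Y.basicOpen (u j)) j)

section AtPrime

variable {A : Type} [CommRing A] [IsNoetherianRing A] {X : Scheme.{0}} (f : X ⟶ Spec (.of A)) [IsProper f] [Flat f]
  (𝔭 : PrimeSpectrum A) {X₀ : Scheme.{0}} {iX : X₀ ⟶ X} {f₀ : X₀ ⟶ Spec (.of 𝔭.asIdeal.ResidueField)}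
  (HX : IsPullback iX f₀ f (Spec.map (CommRingCat.ofHom (algebraMap A 𝔭.asIdeal.ResidueField))))
  {E : X.Modules} (F : FrameSystem E) (h1 : ∀ x, F.rank x = 1)
  (hvan : Subsingleton (Ext.{1} (unitModule X₀) ((Scheme.Modules.pullback iX).obj E) 1))
  (h1₀ : ∀ x, (F.pullback iX).rank x = 1)
  (hgen₀ : ∀ y : X₀, ∃ σ : Γ((Scheme.Modules.pullback iX).obj E, ⊤),
    y ∈ X₀.basicOpen (coeffAt (F.pullback iX) h1₀ id σ y))

include HX hvan hgen₀

/-- **Global sections generate along a fibre where the restriction is generated and `H¹` vanishes** (EGA III 4.7.1 /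
Mumford §5 Cor. 3, relative-generation half): with `f` proper flat over noetherian `A`, `X₀ = X ×_A κ(𝔭)`,
`Ext¹(𝒪_{X₀}, E|_{X₀}) = 0` and `E|_{X₀}` generated by its global sections, every point `x` over `𝔭` has a GLOBAL section
`t ∈ Γ(X, E)` with a unit coefficient at `x` (`coeffAt` in the frame at `x`, family `id` of all global sections).
[cite: EGAIII1, Thm. 4.7.1] [cite: MumfordAV1970, §5 Cor. 3 (p. 53)] -/
theorem exists_mem_basicOpen_coeffAt_of_fibre (x : X) (hx : f x = 𝔭) :
    ∃ t : Γ(E, ⊤), x ∈ X.basicOpen (coeffAt F h1 id t x) := by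
  classical
  -- `x = iX y` for a point `y` of the fibre
  have h𝔭 : f x = (Spec.map (CommRingCat.ofHom (algebraMap A 𝔭.asIdeal.ResidueField)))
      (⊥ : PrimeSpectrum 𝔭.asIdeal.ResidueField) := by
    rw [hx]
    show 𝔭 = PrimeSpectrum.comap (algebraMap A 𝔭.asIdeal.ResidueField) ⊥
    ext1
    rw [PrimeSpectrum.comap_asIdeal, PrimeSpectrum.asIdeal_bot, ← RingHom.ker_eq_comap_bot,
      Ideal.ker_algebraMap_residueField]
  obtain ⟨y, rfl⟩ := mem_range_fst_of_isPullback HX x (⊥ : PrimeSpectrum 𝔭.asIdeal.ResidueField) h𝔭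
  -- a fibre section `σ` generating at `y`, written as a `κ(𝔭)`-combination of restricted global sections (★ G5)
  obtain ⟨σ, hσ⟩ := hgen₀ y
  let E₀ : X₀.Modules := (Scheme.Modules.pullback iX).obj E
  let η : Γ(E, ⊤) → Γ(E₀, ⊤) := fun u ↦ unitSectionLE iX E (V := ⊤) (U := ⊤) le_top u
  have hspan := span_unitSectionLE_top_eq_top_at_prime f E F.isFiniteLocallyFree 𝔭.asIdeal HX hvan
  obtain ⟨c, hc⟩ := Finsupp.mem_span_range_iff_exists_finsupp.mp
    (show SecMod.mk (ρ := f₀.appTop.hom) σ ∈ _ by rw [hspan]; exact Submodule.mem_top)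
  -- in `Γ(X₀, E|X₀)`: `σ = ∑_{u ∈ supp c} (f₀♯ c_u)|_⊤ • η(u)`
  let t : c.support → Γ(E, ⊤) := fun u ↦ SecMod.val (L := E) (ρ := f.appTop.hom) u.1
  have hrel : id σ = ∑ u ∈ (Finset.univ : Finset c.support), toSections f₀.appTop.hom ⊤ (c u.1) • η (t u) := by
    have h := congrArg (SecMod.val (L := E₀) (ρ := f₀.appTop.hom)) hc
    rw [SecMod.val_mk] at h
    rw [id, ← h, Finsupp.sum, ← Finset.sum_coe_sort c.support]
    induction (Finset.univ : Finset c.support) using Finset.induction_on with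
    | empty => rfl
    | insert j T hj ih => rw [Finset.sum_insert hj, Finset.sum_insert hj, SecMod.val_add, ih]; rfl
  -- the coefficient of `σ` at `y` is the corresponding combination of the coefficients of the `η(t u)`
  have hcoeff := coeffAt_sum_smul (F.pullback iX) h1₀ Finset.univ
    (fun u : c.support ↦ toSections f₀.appTop.hom ⊤ (c u.1)) (fun u : c.support ↦ η (t u)) id σ hrel y
  rw [show coeffAt (F.pullback iX) h1₀ id σ y = _ from hcoeff] at hσ
  -- hence some `η(t u)` has a unit coefficient at `y`, i.e. `t u` has one at `iX y`
  obtain ⟨u, hu⟩ := Opens.mem_iSup.mp (basicOpen_sum_mul_le _ _ _ hσ)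
  exact ⟨t u, mem_basicOpen_coeffAt_of_pullback iX F h1 t h1₀ u y hu⟩

end AtPrime

section AllPrimes

variable {A : Type} [CommRing A] [IsNoetherianRing A] {X : Scheme.{0}} (f : X ⟶ Spec (.of A)) [IsProper f] [Flat f]
  {E : X.Modules} (F : FrameSystem E) (h1 : ∀ x, F.rank x = 1)
  (hvan : ∀ 𝔭 : PrimeSpectrum A, Subsingleton (Ext.{1}
    (unitModule (pullback f (Spec.map (CommRingCat.ofHom (algebraMap A 𝔭.asIdeal.ResidueField)))))
    ((Scheme.Modules.pullback
      (pullback.fst f (Spec.map (CommRingCat.ofHom (algebraMap A 𝔭.asIdeal.ResidueField))))).obj E) 1))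
  (hgen : ∀ (𝔭 : PrimeSpectrum A)
    (y : ↑(pullback f (Spec.map (CommRingCat.ofHom (algebraMap A 𝔭.asIdeal.ResidueField))))),
    ∃ σ : Γ((Scheme.Modules.pullback
      (pullback.fst f (Spec.map (CommRingCat.ofHom (algebraMap A 𝔭.asIdeal.ResidueField))))).obj E, ⊤),
      y ∈ (pullback f (Spec.map (CommRingCat.ofHom (algebraMap A 𝔭.asIdeal.ResidueField)))).basicOpen
        (coeffAt (F.pullback (pullback.fst f (Spec.map (CommRingCat.ofHom (algebraMap A 𝔭.asIdeal.ResidueField)))))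
          (fun _ ↦ h1 _) id σ y))

include hvan hgen

/-- **Global generation from the fibres**: if on EVERY fibre `X_𝔭 = X ×_A κ(𝔭)` (Mathlib `pullback` along `Spec κ(𝔭) → Spec A`)
`Ext¹(𝒪, E|_{X_𝔭}) = 0` and `E|_{X_𝔭}` is generated by its global sections, then `E` is generated by the global sections `Γ(X, E)`
at every point of `X` (`f` proper flat, `A` noetherian). [cite: EGAIII1, Thm. 4.7.1] [cite: MumfordAV1970, §5 Cor. 3 (p. 53)] -/
theorem forall_exists_mem_basicOpen_coeffAt_of_fibres (x : X) : ∃ t : Γ(E, ⊤), x ∈ X.basicOpen (coeffAt F h1 id t x) :=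
  exists_mem_basicOpen_coeffAt_of_fibre f (f x) (IsPullback.of_hasPullback f _) F h1 (hvan (f x)) (fun _ ↦ h1 _)
    (hgen (f x)) x rfl

/-- The same as the COVER hypothesis of ★ `GeneratingSections.ofCocycleSections` for the family of all global sections:
`⨆_{t ∈ Γ(X,E), x} X_{coeffAt id t x} = X`, so that `(E, Γ(X, E))` defines the morphism `X → ℙ(Γ(X, E))` of Hartshorne II
Thm. 7.1 (★ `iSup_basicOpen_coeffAt_eq_top_iff`). [cite: Hartshorne1977, II Thm. 7.1] -/
theorem iSup_basicOpen_coeffAt_id_eq_top_of_fibres :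
    ⨆ t : Γ(E, ⊤), ⨆ x : X, X.basicOpen (coeffAt F h1 id t x) = ⊤ :=
  (iSup_basicOpen_coeffAt_eq_top_iff F h1 id).mpr (forall_exists_mem_basicOpen_coeffAt_of_fibres f F h1 hvan hgen)

end AllPrimes

end Literature.AlgebraicGeometry.Morphisms
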